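/-
Origin: expansion seat `planner-pub-hodgecm-pv05-g4-0`, handover #2 2026-08-18T07:55:09Z (`HOME/pub-hodgecm-pv05-g4/lean/Pv05g4/FockSeesawKTypes.lean`, md5 491f69c7, 287 lines);
landed by the gen-7 packager in gate run 26 as `HodgeCM/PerL34/FockSeesawKTypes.lean` (import ^import Pv[0-9]+g[0-9]+\.→import HodgeCM.PerL34. ×1).
-/
/-
Origin: HOME/pub-hodgecm-pv05-g4/lean/Pv05g4/FockSeesawKTypes.lean — session planner-pub-hodgecm-pv05-g4-0 (unit pub-hodgecm-pv05-g4,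
DAG-node prover #05 gen 4), node `FockSeesaw` part 2.  Intended final place: `HodgeCM/PerL34/FockSeesawKTypes.lean`.
Imports the landed `HodgeCM.PerL34.FockLieModule` (pv05-g3, gate run 24) and this seat's `FockSeesaw` (run 26 queue;
packager rewrite `^import Pv05g4\.FockSeesaw$` ↦ `import HodgeCM.PerL34.FockSeesaw`); asserts nothing, cites nothing.
-/
import Mathlib.RingTheory.MvPolynomial.WeightedHomogeneous
import Mathlib.Algebra.DirectSum.Decomposition
import Summits.HodgeConjecture.HodgeCM.PerL34.FockLieModule
import Summits.HodgeConjecture.HodgeCM.PerL34.FockSeesaw_2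

set_option autoImplicit false

/-!
# Lemma 3.4 (seesaw) at `ι₁`, ISOTYPIC form: the `T = U(W₁)×U(W₂)`-type-`(k,l)` part of the plane Fock model is
# `F_k ⊗ F_l`, and it is a `𝔤𝔩₃`-submodule for the diagonal action

Continuation of `FockSeesaw.lean` (same node, same kind: KERNEL, hypothesis-free).  There the tensor decomposition
`pairEquiv : ℂ[z₁,z₂,w] ⊗ ℂ[z₁,z₂,w] ≃ₐ ℂ[z_{aj}, w_j]` and the seesaw identity `ω_W(X) = ω_{W₁}(X)⊗1 + 1⊗ω_{W₂}(X)` were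
proved.  Here the `T`-ISOTYPIC bookkeeping that PerL v5 uses downstream of Lemma 3.4 (proof of Lemma 3.5 `lem:S12`,
tex ll. 355–361: `𝒫 = 𝒫₁ ⊗ 𝒫₂`, "Fock polynomials of pure `K_∞`-types", "`θ(φ_j,χ'_j) ∈ π_j` has the `K_∞`-type of
`φ_j`" — cf. those lines, no further quotation intended; and the `U(1)²`-weights `(k,l)` of node N19-gen at `ι₁`) is made a
theorem about the explicit models:

* `biPiece k l := pairMap (F_k ⊗ F_l)` (`F_k = hpiece k`, pv05-g3/pv12: the `U(1)_W`-type-`k` piece of the one-line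
  model, an irreducible `𝔤𝔩₃`-module by `FockLieModule.fockPiece_isIrreducible`);
* **`biPiece_eq_inf : biPiece k l = wpiece (colWt 0) k ⊓ wpiece (colWt 1) l`** — the joint `(U(W₁),U(W₂))`-weight-`(k,l)`
  eigenspace of the plane model (pv12 `ArchB.colWt`) IS `F_k ⊗ F_l`: "`ω_W|_T ≅ ω_{W₁}|_{U(W₁)} ⊗ ω_{W₂}|_{U(W₂)}`" read
  isotypic component by isotypic component (`⊇` is the content: every bi-weight vector is a sum of products);
* `iSup_biPiece_eq_top` — the pieces exhaust the plane model;
* **`planeOsc_mem_biPiece` / `planeOscRep_mem_biPiece`** — each `F_k ⊗ F_l` is stable under the DIAGONAL `𝔤𝔩₃`-action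
  `ω_W|_{𝔲(V)_ℂ}` (because `T` and `U(V)` commute: the seesaw), so that `ω_W|_{𝔲(V)_ℂ × T}^{K-fin} = ⊕_{k,l}
  (F_k ⊗ F_l) ⊠ (χ^k ⊠ χ^l)`;
* `biPiece_ne_bot` — every `(k,l) ∈ ℤ²` occurs.

Tools: the monomial splitting `planeExp_split` / `monomial_eq_pairMap` along `varEquiv`, pv05-g3's `wpiece` API
(`mem_wpiece_iff_support`, `monomial_mem_wpiece`) and `osc_mem_hpiece` (`FockGL3`).

PRINT residual: as in `FockSeesaw.lean` (group level / unitary completion / global: pv11 `Seesaw.lean` (b)); nothing new.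

PACKAGER: additive leaf; nothing imports it; ONE import rewrite (`Pv05g4.FockSeesaw` ↦ `HodgeCM.PerL34.FockSeesaw`);
lands after `FockSeesaw.lean` (run 26 #1 of this seat) and the tree's `FockLieModule`; axioms trio.
-/

namespace HodgeCM
namespace PerL34
namespace Fock

open MvPolynomial TensorProduct

/-! ## 1. Splitting plane exponents and monomials along the two lines -/

section Monomials

/-- The exponent of a plane monomial restricted to the variables of line `j`. -/
noncomputable def lineExp (j : Fin 2) (m : PlaneVar →₀ ℕ) : HarmVar →₀ ℕ :=
  m.comapDomain (lineVar j) (lineVar_injective j).injOn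

/-- (Ported verbatim from the HodgeCMPerL package; no docstring in the source.) -/
@[simp] theorem lineExp_apply (j : Fin 2) (m : PlaneVar →₀ ℕ) (u : HarmVar) :
    lineExp j m u = m (lineVar j u) := by
  simp only [lineExp, Finsupp.comapDomain_apply]

/-- (Ported verbatim from the HodgeCMPerL package; no docstring in the source.) -/
theorem lineVar_notMem_range {j j' : Fin 2} (h : j ≠ j') (u : HarmVar) :
    lineVar j u ∉ Set.range (lineVar j') := by
  rintro ⟨v, hv⟩
  exact lineVar_ne j' j (Ne.symm h) v u hv

/-- A plane exponent is the sum of its two line parts ("the union of the two sets of variables"). -/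
theorem planeExp_split (m : PlaneVar →₀ ℕ) :
    m = (lineExp 0 m).mapDomain (lineVar 0) + (lineExp 1 m).mapDomain (lineVar 1) := by
  ext v
  obtain ⟨x, rfl⟩ := varEquiv.surjective v
  rcases x with u | u
  · rw [varEquiv_inl, Finsupp.add_apply, Finsupp.mapDomain_apply (lineVar_injective 0),
      Finsupp.mapDomain_notin_range _ _ (lineVar_notMem_range (show (0 : Fin 2) ≠ 1 by decide) u),
      add_zero, lineExp_apply]
  · rw [varEquiv_inr, Finsupp.add_apply, Finsupp.mapDomain_apply (lineVar_injective 1),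
      Finsupp.mapDomain_notin_range _ _ (lineVar_notMem_range (show (1 : Fin 2) ≠ 0 by decide) u),
      zero_add, lineExp_apply]

/-- Torus weights split along the lines. -/
theorem wt_plane_split (s : PlaneVar → ℤ) (m : PlaneVar →₀ ℕ) :
    wt s m = wt (s ∘ lineVar 0) (lineExp 0 m) + wt (s ∘ lineVar 1) (lineExp 1 m) := by
  rw [wt, wt, wt, ← Equiv.sum_comp varEquiv, Fintype.sum_sum_type]
  simp only [varEquiv_inl, varEquiv_inr, Function.comp_apply, lineExp_apply]

/-- (Ported verbatim from the HodgeCMPerL package; no docstring in the source.) -/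
theorem wt_const_zero {σ : Type*} [Fintype σ] (n : σ →₀ ℕ) : wt (fun _ => (0 : ℤ)) n = 0 := by
  simp [wt]

/-- The `U(W₁)`-weight of a plane monomial is the `U(1)_W`-weight of its line-`0` part … -/
theorem wt_colWt_zero (m : PlaneVar →₀ ℕ) : wt (colWt 0) m = wt uWt (lineExp 0 m) := by
  rw [wt_plane_split, colWt_comp_lineVar_self, colWt_comp_lineVar_of_ne (show (1 : Fin 2) ≠ 0 by decide),
    wt_const_zero, add_zero]

/-- … and its `U(W₂)`-weight is the `U(1)_W`-weight of its line-`1` part. -/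
theorem wt_colWt_one (m : PlaneVar →₀ ℕ) : wt (colWt 1) m = wt uWt (lineExp 1 m) := by
  rw [wt_plane_split, colWt_comp_lineVar_self, colWt_comp_lineVar_of_ne (show (0 : Fin 2) ≠ 1 by decide),
    wt_const_zero, zero_add]

/-- Every plane monomial is a product of a line-`0` monomial and a line-`1` monomial, i.e. a pure tensor. -/
theorem monomial_eq_pairMap (m : PlaneVar →₀ ℕ) (c : ℂ) :
    (monomial m c : PlaneModel) = pairMap (monomial (lineExp 0 m) c ⊗ₜ[ℂ] monomial (lineExp 1 m) 1) := by
  rw [pairMap_tmul, lineEmb_apply, lineEmb_apply, rename_monomial, rename_monomial, monomial_mul, mul_one,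
    ← planeExp_split]

end Monomials

/-! ## 2. The bi-isotypic pieces `F_k ⊗ F_l` of the plane model -/

section BiPiece

/-- `F_k ⊗ F_l` placed inside the plane model: the image under the multiplication isomorphism `pairMap` of
`hpiece k ⊗ hpiece l ≤ HarmModel ⊗ HarmModel`. -/
noncomputable def biPiece (k l : ℤ) : Submodule ℂ PlaneModel :=
  Submodule.map (pairMap.toLinearMap : HarmModel ⊗[ℂ] HarmModel →ₗ[ℂ] PlaneModel)
    (LinearMap.range (TensorProduct.mapIncl (hpiece k) (hpiece l)))

/-- (Ported verbatim from the HodgeCMPerL package; no docstring in the source.) -/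
theorem pairMap_tmul_mem_biPiece {k l : ℤ} {φ ψ : HarmModel} (hφ : φ ∈ hpiece k) (hψ : ψ ∈ hpiece l) :
    pairMap (φ ⊗ₜ[ℂ] ψ) ∈ biPiece k l :=
  Submodule.mem_map.mpr ⟨φ ⊗ₜ[ℂ] ψ, ⟨⟨φ, hφ⟩ ⊗ₜ[ℂ] ⟨ψ, hψ⟩, by simp [TensorProduct.map_tmul]⟩, rfl⟩

/-- Induction principle for `biPiece`: it is generated by the products `φψ`, `φ ∈ F_k`, `ψ ∈ F_l`. -/
theorem biPiece_induction {k l : ℤ} {p : PlaneModel → Prop} (h0 : p 0)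
    (htmul : ∀ φ ∈ hpiece k, ∀ ψ ∈ hpiece l, p (pairMap (φ ⊗ₜ[ℂ] ψ)))
    (hadd : ∀ f g, p f → p g → p (f + g)) : ∀ f ∈ biPiece k l, p f := by
  rintro f ⟨x, ⟨y, rfl⟩, rfl⟩
  induction y using TensorProduct.induction_on with
  | zero => simpa using h0
  | tmul a b => simpa [TensorProduct.map_tmul] using htmul a a.2 b b.2
  | add y y' hy hy' => simpa [map_add] using hadd _ _ hy hy'

/-- `F_k ⊗ F_l` has `T = U(W₁)×U(W₂)`-weight `(k,l)`. -/
theorem biPiece_le_inf (k l : ℤ) : biPiece k l ≤ wpiece (colWt 0) k ⊓ wpiece (colWt 1) l := by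
  intro f hf
  refine biPiece_induction (p := fun f => f ∈ wpiece (colWt 0) k ⊓ wpiece (colWt 1) l) (Submodule.zero_mem _)
    (fun φ hφ ψ hψ => ?_) (fun f g hf hg => Submodule.add_mem _ hf hg) f hf
  obtain ⟨h0, h1⟩ := weightOp_colWt_pairMap_tmul_of_mem hφ hψ
  exact Submodule.mem_inf.mpr ⟨(mem_wpiece_iff _ _ _).mpr h0, (mem_wpiece_iff _ _ _).mpr h1⟩

/-- (Ported verbatim from the HodgeCMPerL package; no docstring in the source.) -/
theorem weightOp_colWt_zero_of_mem_biPiece {k l : ℤ} {f : PlaneModel} (hf : f ∈ biPiece k l) :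
    weightOp (colWt 0) f = (k : ℂ) • f :=
  (mem_wpiece_iff _ _ _).mp (Submodule.mem_inf.mp (biPiece_le_inf k l hf)).1

/-- (Ported verbatim from the HodgeCMPerL package; no docstring in the source.) -/
theorem weightOp_colWt_one_of_mem_biPiece {k l : ℤ} {f : PlaneModel} (hf : f ∈ biPiece k l) :
    weightOp (colWt 1) f = (l : ℂ) • f :=
  (mem_wpiece_iff _ _ _).mp (Submodule.mem_inf.mp (biPiece_le_inf k l hf)).2

/-- Every plane monomial lies in the bi-piece of its two column weights. -/
theorem monomial_mem_biPiece (m : PlaneVar →₀ ℕ) (c : ℂ) :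
    (monomial m c : PlaneModel) ∈ biPiece (wt (colWt 0) m) (wt (colWt 1) m) := by
  rw [monomial_eq_pairMap, wt_colWt_zero, wt_colWt_one]
  exact pairMap_tmul_mem_biPiece (monomial_mem_wpiece rfl c) (monomial_mem_wpiece rfl 1)

/-- The content: every vector of `T`-weight `(k,l)` is a sum of products `φψ` with `φ ∈ F_k`, `ψ ∈ F_l`. -/
theorem inf_le_biPiece (k l : ℤ) : wpiece (colWt 0) k ⊓ wpiece (colWt 1) l ≤ biPiece k l := by
  intro f hf
  rw [Submodule.mem_inf, mem_wpiece_iff_support, mem_wpiece_iff_support] at hf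
  rw [f.as_sum]
  refine Submodule.sum_mem _ fun m hm => ?_
  have h := monomial_mem_biPiece m (coeff m f)
  rwa [hf.1 m hm, hf.2 m hm] at h

/-- **`T`-isotypic form of Lemma 3.4 at `ι₁`**: the `(χ^k ⊠ χ^l)`-isotypic subspace of the plane Fock model under
`T = U(W₁)×U(W₂)` is exactly `F_k ⊗ F_l`. -/
theorem biPiece_eq_inf (k l : ℤ) : biPiece k l = wpiece (colWt 0) k ⊓ wpiece (colWt 1) l :=
  le_antisymm (biPiece_le_inf k l) (inf_le_biPiece k l)

/-- (Ported verbatim from the HodgeCMPerL package; no docstring in the source.) -/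
theorem mem_biPiece_iff (k l : ℤ) (f : PlaneModel) :
    f ∈ biPiece k l ↔ weightOp (colWt 0) f = (k : ℂ) • f ∧ weightOp (colWt 1) f = (l : ℂ) • f := by
  rw [biPiece_eq_inf, Submodule.mem_inf, mem_wpiece_iff, mem_wpiece_iff]

/-- The bi-pieces exhaust the plane model. -/
theorem iSup_biPiece_eq_top : ⨆ kl : ℤ × ℤ, biPiece kl.1 kl.2 = ⊤ := by
  rw [eq_top_iff]
  rintro f -
  rw [f.as_sum]
  refine Submodule.sum_mem _ fun m _ => ?_
  exact Submodule.mem_iSup_of_mem (wt (colWt 0) m, wt (colWt 1) m) (monomial_mem_biPiece m _)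

/-- (Ported verbatim from the HodgeCMPerL package; no docstring in the source.) -/
theorem exists_mem_hpiece_ne_zero (k : ℤ) : ∃ φ ∈ hpiece k, φ ≠ 0 := by
  refine ⟨hmon k.toNat 0 (-k).toNat, ?_, hmon_ne_zero _ _ _⟩
  have e : ((k.toNat : ℕ) : ℤ) + ((0 : ℕ) : ℤ) - (((-k).toNat : ℕ) : ℤ) = k := by omega
  have h := hmon_mem_hpiece k.toNat 0 (-k).toNat
  rwa [e] at h

/-- Every `(k,l) ∈ ℤ²` occurs. -/
theorem biPiece_ne_bot (k l : ℤ) : biPiece k l ≠ ⊥ := by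
  obtain ⟨φ, hφ, hφ0⟩ := exists_mem_hpiece_ne_zero k
  obtain ⟨ψ, hψ, hψ0⟩ := exists_mem_hpiece_ne_zero l
  intro h
  have hmem := pairMap_tmul_mem_biPiece hφ hψ
  rw [h, Submodule.mem_bot, pairMap_tmul] at hmem
  have hinj : ∀ j : Fin 2, Function.Injective (lineEmb j) := fun j => by
    rw [lineEmb_eq_rename]; exact rename_injective _ (lineVar_injective j)
  rcases mul_eq_zero.mp hmem with h0 | h1
  · exact hφ0 ((injective_iff_map_eq_zero _).mp (hinj 0) φ h0)
  · exact hψ0 ((injective_iff_map_eq_zero _).mp (hinj 1) ψ h1)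

end BiPiece

/-! ## 2b. `ℂ[z_{aj}, w_j] = ⊕_{(k,l) ∈ ℤ²} F_k ⊗ F_l` (internal direct sum) -/

section Decomposition

/-- The `ℤ²`-valued `T`-weight of a plane variable: (`U(W₁)`-weight, `U(W₂)`-weight). -/
def biWt : PlaneVar → ℤ × ℤ := fun v => (colWt 0 v, colWt 1 v)

/-- (Ported verbatim from the HodgeCMPerL package; no docstring in the source.) -/
theorem weight_biWt (m : PlaneVar →₀ ℕ) : Finsupp.weight biWt m = (wt (colWt 0) m, wt (colWt 1) m) := by
  rw [wt_eq_weight, wt_eq_weight, Finsupp.weight_apply, Finsupp.weight_apply, Finsupp.weight_apply]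
  simp only [Finsupp.sum, biWt]
  ext
  · rw [Prod.fst_sum]
    exact Finset.sum_congr rfl fun i _ => by rw [Prod.smul_fst]
  · rw [Prod.snd_sum]
    exact Finset.sum_congr rfl fun i _ => by rw [Prod.smul_snd]

/-- `F_k ⊗ F_l` is Mathlib's weighted-homogeneous submodule for the `ℤ²`-weights `biWt`. -/
theorem biPiece_eq_weightedHomogeneousSubmodule (k l : ℤ) :
    biPiece k l = weightedHomogeneousSubmodule ℂ biWt (k, l) := by
  ext f
  rw [biPiece_eq_inf, Submodule.mem_inf, mem_wpiece_iff_support, mem_wpiece_iff_support,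
    mem_weightedHomogeneousSubmodule, IsWeightedHomogeneous]
  simp only [MvPolynomial.mem_support_iff, weight_biWt, Prod.mk.injEq]
  exact ⟨fun h m hm => ⟨h.1 m hm, h.2 m hm⟩, fun h => ⟨fun m hm => (h hm).1, fun m hm => (h hm).2⟩⟩

/-- **`𝓕(V₃⊗W)^{K-fin}_{ι₁} = ⊕_{(k,l) ∈ ℤ²} F_k ⊗ F_l`** (internal direct sum of the `T`-isotypic pieces): with
`biPiece_eq_inf`, `planeOscRep_mem_biPiece` (below) and pv05-g3's `fockPiece_isIrreducible` / `fockPiece_hom_eq_zero`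
this is the complete `K`-finite form at `ι₁` of "`ω_W|_{T×G_U} ≅ ω_{W₁} ⊗ ω_{W₂}`" of Lemma 3.4. -/
theorem biPiece_isInternal : DirectSum.IsInternal fun kl : ℤ × ℤ => biPiece kl.1 kl.2 := by
  classical
  have h : (fun kl : ℤ × ℤ => biPiece kl.1 kl.2) = weightedHomogeneousSubmodule ℂ biWt :=
    funext fun kl => biPiece_eq_weightedHomogeneousSubmodule kl.1 kl.2
  rw [h]
  letI := weightedDecomposition ℂ biWt
  exact DirectSum.Decomposition.isInternal _

/-- In particular distinct bi-weights give independent pieces. -/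
theorem biPiece_iSupIndep : iSupIndep fun kl : ℤ × ℤ => biPiece kl.1 kl.2 :=
  biPiece_isInternal.submodule_iSupIndep

end Decomposition

/-! ## 3. `F_k ⊗ F_l` is a `𝔤𝔩₃`-submodule for the diagonal action (the seesaw: `T` and `U(V)` commute) -/

section Stability

attribute [local instance 100] LieRing.ofAssociativeRing

/-- The diagonal oscillator operators preserve each `F_k ⊗ F_l`. -/
theorem planeOsc_mem_biPiece (k l : ℤ) (i i' : HarmVar) : ∀ f ∈ biPiece k l, planeOsc i i' f ∈ biPiece k l := by
  intro f hf
  refine biPiece_induction (p := fun f => planeOsc i i' f ∈ biPiece k l) (by simp) (fun φ hφ ψ hψ => ?_)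
    (fun f g hf hg => by simpa [map_add] using Submodule.add_mem _ hf hg) f hf
  rw [planeOsc_pairMap_tmul]
  exact Submodule.add_mem _ (pairMap_tmul_mem_biPiece (osc_mem_hpiece k i i' φ hφ) hψ)
    (pairMap_tmul_mem_biPiece hφ (osc_mem_hpiece l i i' ψ hψ))

/-- Hence so does `ω_W(A)` for every `A ∈ 𝔤𝔩₃(ℂ)`: `F_k ⊗ F_l` is a `𝔤𝔩₃`-submodule of the plane model, and
`𝓕(V₃⊗W)^{K-fin}_{ι₁} = ⊕_{k,l} (F_k ⊗ F_l) ⊠ (χ^k ⊠ χ^l)` as a `(𝔲(V)_ℂ, T)`-module. -/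
theorem planeOscRep_mem_biPiece (k l : ℤ) (A : Matrix HarmVar HarmVar ℂ) :
    ∀ f ∈ biPiece k l, planeOscRep A f ∈ biPiece k l := by
  intro f hf
  rw [planeOscRep_apply, LinearMap.sum_apply]
  refine Submodule.sum_mem _ fun i _ => ?_
  rw [LinearMap.sum_apply]
  refine Submodule.sum_mem _ fun i' _ => ?_
  rw [LinearMap.smul_apply]
  exact Submodule.smul_mem _ _ (planeOsc_mem_biPiece k l i i' f hf)

/-- The two commuting one-line copies also preserve `F_k ⊗ F_l` (the big member `U(V)×U(V)` of the seesaw pair). -/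
theorem lineOsc_mem_biPiece (k l : ℤ) (j : Fin 2) (i i' : HarmVar) :
    ∀ f ∈ biPiece k l, lineOsc j i i' f ∈ biPiece k l := by
  intro f hf
  refine biPiece_induction (p := fun f => lineOsc j i i' f ∈ biPiece k l) (by simp) (fun φ hφ ψ hψ => ?_)
    (fun f g hf hg => by simpa [map_add] using Submodule.add_mem _ hf hg) f hf
  have hj : j = 0 ∨ j = 1 := by fin_cases j <;> simp
  rcases hj with rfl | rfl
  · rw [pairMap_tmul, lineOsc_zero_mul, ← pairMap_tmul]
    exact pairMap_tmul_mem_biPiece (osc_mem_hpiece k i i' φ hφ) hψ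
  · rw [pairMap_tmul, lineOsc_one_mul, ← pairMap_tmul]
    exact pairMap_tmul_mem_biPiece hφ (osc_mem_hpiece l i i' ψ hψ)

end Stability

end Fock
end PerL34
end HodgeCM
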